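import Mathlib
import Summits.Ventures.HodgeRepro.Tier4.Line4.TailSeesawRatio
import Summits.Ventures.HodgeRepro.Tier4.Line4.TorusProductHaar
import Summits.Ventures.HodgeRepro.Tier4.Line4.TorusFinSplitHaar
import Summits.Ventures.HodgeRepro.Tier4.Line4.GASplit
import Summits.Ventures.HodgeRepro.Tier4.Line4.ArchCutoffLarge
import Summits.Ventures.HodgeRepro.Tier4.Common.TorusInfCompactConj

/-!
# Tier4/Line4/TailSeesawHaar — C-L4-7B-ASSEMBLY at the plane of record with the HAAR NORMALISATIONS and the COMPACTNESS of
the archimedean tori BY NAME: the (7b) display body of `TailSeesawRatio` with `νf' μinf μ₀ νS` chosen (`Measure.haar`), the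
constants `c c' c₀ cq` with their equations discharged by Haar uniqueness, and the two `CompactSpace` instances from the
sign data

Blind re-derivation cell `pub-hodge-repro`, Tier 4 «prove the step» (README §9–§10), seat t4-L2-p2 (gen 6; S16189: the
theorem first prepared as `TailSeesawRatio` v2, moved to its own module for the 400-line statement-form lint).  Tree path
`lean/Summits/Ventures/HodgeRepro/Tier4/Line4/TailSeesawHaar.lean`.  Imports this seat's `Line4/TailSeesawRatio`
(`tailForArch_seesaw_of_ratio`), L2-p1's `Line4/TorusProductHaar` (`exists_smul_map_prod_eq`, `exists_smul_map_prod_eq'`,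
`locallyCompact_torusFin'`) and `Line4/TorusFinSplitHaar` (`exists_smul_map_prod_eq_fin`, `locallyCompact_torusFinAt`),
L4-p1's `Line4/GASplit` (`exists_smul_map_prod_eq_ga`, `locallyCompact_infinitePart`, `locallyCompact_finitePart`),
L1-p5's `Line4/ArchCutoffLarge` (`compactSpace_torusInf_seesaw`) and typer-2's `Common/TorusInfCompactConj`
(`compactSpace_infinitePart_subgroupOf_torusT'_seesaw`).  Mathlib-level; no literature; no `def`.  TWO THEOREMS:
`tailForArch_seesaw_of_ratio_haar` (the Haar normalisations by name) and `tailForArch_seesaw_of_ratio_compact` (+ the two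
`CompactSpace` instances by name).

**`tailForArch_seesaw_of_ratio_haar`**: `tailForArch_seesaw_of_ratio` with the 11 binders `νf' [IsHaar] · c hc0 hcμ ·
c' hc0' hcμ' · μinf [IsHaar] μ₀ [IsHaar] c₀ hc₀ hcμ₀ · νS [IsHaar] cq hcq` DELETED — every other binder and the conclusion
token-identical.  `νf'`, `μinf`, `μ₀`, `νS` are Mathlib's `Measure.haar` on the locally compact closed subgroups `T′_f`,
`G_∞`, `G_f`, `T_S`; `c c' c₀ cq` and their equations are Haar uniqueness on `T(𝔸) = T_∞ × T_f`, `T′(𝔸)`, `G(𝔸) = G_∞ × G_f`,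
`T_f = T_S × T_f^{(p)}`.  The archimedean pair `νinf νinf'` stays (it is in the statement: `IsArchCoeffD … νinf νinf'`), `νf`
stays (the `Z(k)`-domain's fundamental-domain clause `hfd` is relative to it), `νA νA'` stay (the display `haway` names them).
THE RESIDUAL (the (7b) census at this layer): `ht` · the two `CompactSpace` instances · the Haar measures `νinf νf νinf' νA νA'`
(no constants, no equations) · the product `Z(k)`-domain data `DA hDA hfd hDZc` · the level prime `p hp hγ₀` · the sign data
`hw hcm hα hβ hdef` · the K-type matching `hchi hchi'` · (S-FIN-NV)'s display `haway`.

Nothing here says anything about the status of the Hodge conjecture for CM abelian varieties, which is NOT proved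
(HC_CM is NOT proved by anyone in this repository).
-/

set_option autoImplicit false

noncomputable section

namespace Summit.Ventures.HodgeRepro.Tier4.Line4

open Matrix MeasureTheory Topology Filter NumberField IsDedekindDomain Summit.Ventures.HodgeRepro.Tier4
  Summit.Ventures.HodgeRepro.Tier4.Common Summit.Ventures.HodgeRepro.Tier4.Line1
  Summit.Ventures.HodgeRepro.Tier4.Line1.RTF Summit.Ventures.HodgeRepro.Tier4.Line4.L1Class

open scoped NumberField NNReal ENNReal Pointwise Matrix ComplexConjugate

section Haar

variable {k : Type} [Field k] [NumberField k]

/-- **The (7b) display body at the plane of record with the Haar normalisations by name**: `tailForArch_seesaw_of_ratio` with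
`νf'`, `μinf`, `μ₀`, `νS` CHOSEN (`Measure.haar` on the locally compact closed subgroups `T′_f`, `G_∞`, `G_f`, `T_S`) and the
constants `c hc0 hcμ`, `c' hc0' hcμ'`, `c₀ hc₀ hcμ₀`, `cq hcq` DISCHARGED by Haar uniqueness (`exists_smul_map_prod_eq`,
`exists_smul_map_prod_eq'`, `exists_smul_map_prod_eq_ga`, `exists_smul_map_prod_eq_fin`).  The archimedean pair `νinf νinf'`
stays (it is in the statement: `IsArchCoeffD … νinf νinf'`), `νf` stays (the `Z(k)`-domain's fundamental-domain clause `hfd`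
is relative to it), `νA νA'` stay (the display `haway` names them).  THE RESIDUAL at this layer: `ht` · the two `CompactSpace`
instances · the Haar measures `νinf νf νinf' νA νA'` · the product `Z(k)`-domain data `DA hDA hfd hDZc` · the level prime
`p hp hγ₀` · the sign data `hw hcm hα hβ hdef` · the K-type matching `hchi hchi'` · (S-FIN-NV)'s display `haway`. -/
theorem tailForArch_seesaw_of_ratio_haar (q : QuadData k) (ht : q.t = 0) (hn : ¬ IsSquare (-q.n))
    (a : Fin 4 → k) (ha : ∀ i, a i ≠ 0)
    (g g' : Matrix (Fin 4) (Fin 4) k) (hgg' : g * g' = 1) (hg'g : g' * g = 1)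
    (hgΩ : g * (PlaneData.mixedRow q (a 0) (a 2)).Ω = (PlaneData.mixedRow q (a 0) (a 2)).Ω * g)
    (lam : k) (hlam : lam ≠ 0)
    (hiso : g * (PlaneData.mixedRow q (a 1) (a 3)).B * gᵀ = lam • (PlaneData.mixedRow q (a 0) (a 2)).B)
    [MeasurableSpace (GA ((PlaneData.mixedRow q (a 0) (a 2)).withTransportedTorus g g' hgg' hg'g hgΩ))] [BorelSpace (GA ((PlaneData.mixedRow q (a 0) (a 2)).withTransportedTorus g g' hgg' hg'g hgΩ))]
    (R : RTFData ((PlaneData.mixedRow q (a 0) (a 2)).withTransportedTorus g g' hgg' hg'g hgΩ)) (hRH : R.IsHaar)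
    (hc : Continuous R.chi) (hu : ∀ a, ‖R.chi a‖ = 1) (hc' : Continuous R.chi') (hu' : ∀ a, ‖R.chi' a‖ = 1)
    (w₀ : InfinitePlace k) (eP eM eP' eM' : InfinitePlace k → ℤ)
    -- the K-type matching of the display (its own `_hchi` / `_hchi'`), in `D : KTypeData`'s place
    (hchi : ∀ w, ChiMatchesAt ((PlaneData.mixedRow q (a 0) (a 2)).withTransportedTorus g g' hgg' hg'g hgΩ) q w (eP w) (eM w) R.chi)
    (hchi' : ∀ w, ChiMatchesAt' ((PlaneData.mixedRow q (a 0) (a 2)).withTransportedTorus g g' hgg' hg'g hgΩ) q w g g' (eP' w) (eM' w) R.chi')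
    [R.μT.IsHaarMeasure] [R.μT'.IsHaarMeasure]
    (μ : Measure (GA ((PlaneData.mixedRow q (a 0) (a 2)).withTransportedTorus g g' hgg' hg'g hgΩ))) [μ.IsHaarMeasure] (DG : Set (GA ((PlaneData.mixedRow q (a 0) (a 2)).withTransportedTorus g g' hgg' hg'g hgΩ))) (fdG : IsFundamentalDomain (rationalPoints ((PlaneData.mixedRow q (a 0) (a 2)).withTransportedTorus g g' hgg' hg'g hgΩ)) DG μ)
    (compG : IsCompact (closure DG)) (compT : IsCompact (closure R.DT)) (compT' : IsCompact (closure R.DT'))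
    (γ₀ : rationalPoints ((PlaneData.mixedRow q (a 0) (a 2)).withTransportedTorus g g' hgg' hg'g hgΩ)) (hlin : IsLinRegular ((PlaneData.mixedRow q (a 0) (a 2)).withTransportedTorus g g' hgg' hg'g hgΩ) γ₀)
    (νinf : Measure (torusInf ((PlaneData.mixedRow q (a 0) (a 2)).withTransportedTorus g g' hgg' hg'g hgΩ))) [νinf.IsHaarMeasure] [CompactSpace (torusInf ((PlaneData.mixedRow q (a 0) (a 2)).withTransportedTorus g g' hgg' hg'g hgΩ))]
    (νf : Measure (torusFin ((PlaneData.mixedRow q (a 0) (a 2)).withTransportedTorus g g' hgg' hg'g hgΩ))) [νf.IsHaarMeasure]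
    (νinf' : Measure (torusInf' ((PlaneData.mixedRow q (a 0) (a 2)).withTransportedTorus g g' hgg' hg'g hgΩ))) [νinf'.IsHaarMeasure] [CompactSpace (torusInf' ((PlaneData.mixedRow q (a 0) (a 2)).withTransportedTorus g g' hgg' hg'g hgΩ))]
    (p : ℕ) (hp : p.Prime)
    (hγ₀ : ∀ v : HeightOneSpectrum (𝓞 k), natSize k v p < 1 → ∀ i j : Fin 4,
      Valued.v (finPart k (GA.mat ((PlaneData.mixedRow q (a 0) (a 2)).withTransportedTorus g g' hgg' hg'g hgΩ) (γ₀ : GA ((PlaneData.mixedRow q (a 0) (a 2)).withTransportedTorus g g' hgg' hg'g hgΩ)) i j) v) ≤ 1 ∧ Valued.v (finPart k (GA.mat ((PlaneData.mixedRow q (a 0) (a 2)).withTransportedTorus g g' hgg' hg'g hgΩ) (γ₀ : GA ((PlaneData.mixedRow q (a 0) (a 2)).withTransportedTorus g g' hgg' hg'g hgΩ))⁻¹ i j) v) ≤ 1)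
    -- the product `Z(k)`-domain of record `torusFinSplit⁻¹(univ ×ˢ DA)` (AwayDomain) and its fundamental-domain /
    -- compactness data (ZDOMAIN-EX (iv) at the product domain); the away measures and (S-FIN-NV)'s display `haway`
    (νA : Measure (torusFinAway ((PlaneData.mixedRow q (a 0) (a 2)).withTransportedTorus g g' hgg' hg'g hgΩ) (placesAbove (k := k) p))) [νA.IsHaarMeasure]
    (νA' : Measure (torusFinAway' ((PlaneData.mixedRow q (a 0) (a 2)).withTransportedTorus g g' hgg' hg'g hgΩ) (placesAbove (k := k) p))) [νA'.IsHaarMeasure]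
    (DA : Set (torusFinAway ((PlaneData.mixedRow q (a 0) (a 2)).withTransportedTorus g g' hgg' hg'g hgΩ) (placesAbove (k := k) p))) (hDA : MeasurableSet DA)
    (hfd : IsFundamentalDomain (centreFin ((PlaneData.mixedRow q (a 0) (a 2)).withTransportedTorus g g' hgg' hg'g hgΩ)) ((torusFinSplit ((PlaneData.mixedRow q (a 0) (a 2)).withTransportedTorus g g' hgg' hg'g hgΩ) (placesAbove (k := k) p)) ⁻¹' (Set.univ ×ˢ DA)) νf)
    (hDZc : ∀ C : Set (torusFin ((PlaneData.mixedRow q (a 0) (a 2)).withTransportedTorus g g' hgg' hg'g hgΩ)), IsCompact C → IsCompact (closure (((torusFinSplit ((PlaneData.mixedRow q (a 0) (a 2)).withTransportedTorus g g' hgg' hg'g hgΩ) (placesAbove (k := k) p)) ⁻¹' (Set.univ ×ˢ DA)) ∩ (C * (ZfIn ((PlaneData.mixedRow q (a 0) (a 2)).withTransportedTorus g g' hgg' hg'g hgΩ) : Set (torusFin ((PlaneData.mixedRow q (a 0) (a 2)).withTransportedTorus g g' hgg' hg'g hgΩ)))))))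
    (haway : awayOrbital ((PlaneData.mixedRow q (a 0) (a 2)).withTransportedTorus g g' hgg' hg'g hgΩ) (placesAbove (k := k) p) R (γ₀ : GA ((PlaneData.mixedRow q (a 0) (a 2)).withTransportedTorus g g' hgg' hg'g hgΩ)) νA νA' DA ≠ 0)
    -- (S-COUNT) BY NAME: the sign data of display (8) in `hcount`'s place — `w₀` (already bound: the indefinite place of
    -- `IsArchCoeffD`) real and CM, the `(1,1)` signs `hα hβ` at `w₀`, and the ONE displayed definiteness clause `hdef`
    (hw : w₀.IsReal) (hcm : IsCMAt q w₀) (hα : 0 < alphaLoc (a 0) hw) (hβ : betaLoc (a 2) (-1) hw < 0)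
    (hdef : SeesawDefinite q a w₀) :
    ∀ finf : GA ((PlaneData.mixedRow q (a 0) (a 2)).withTransportedTorus g g' hgg' hg'g hgΩ) → ℂ,
      IsArchCoeffD ((PlaneData.mixedRow q (a 0) (a 2)).withTransportedTorus g g' hgg' hg'g hgΩ) (Setting.ofAdelicData ((PlaneData.mixedRow q (a 0) (a 2)).withTransportedTorus g g' hgg' hg'g hgΩ) R μ DG fdG compG compT compT') R q g g' w₀ eP eM eP' eM'
        (γ₀ : GA ((PlaneData.mixedRow q (a 0) (a 2)).withTransportedTorus g g' hgg' hg'g hgΩ)) νinf νinf' finf →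
      ∃ lev : ℕ → ℕ, (∀ n, lev n ≠ 0) ∧
      ∃ ffin f₂ : ℕ → GA ((PlaneData.mixedRow q (a 0) (a 2)).withTransportedTorus g g' hgg' hg'g hgΩ) → ℂ, TailFamily' ((PlaneData.mixedRow q (a 0) (a 2)).withTransportedTorus g g' hgg' hg'g hgΩ) q g g' eP' eM' (γ₀ : GA ((PlaneData.mixedRow q (a 0) (a 2)).withTransportedTorus g g' hgg' hg'g hgΩ)) ffin f₂ ∧
        ∃ E : Finset (Setting.ofAdelicData ((PlaneData.mixedRow q (a 0) (a 2)).withTransportedTorus g g' hgg' hg'g hgΩ) R μ DG fdG compG compT compT').Orbit,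
          (Setting.ofAdelicData ((PlaneData.mixedRow q (a 0) (a 2)).withTransportedTorus g g' hgg' hg'g hgΩ) R μ DG fdG compG compT compT').orbitOf γ₀ ∈ E ∧
          FibreDominatedFrom (Setting.ofAdelicData ((PlaneData.mixedRow q (a 0) (a 2)).withTransportedTorus g g' hgg' hg'g hgΩ) R μ DG fdG compG compT compT') R.chi R.chi' E
            (fun n => (Setting.ofAdelicData ((PlaneData.mixedRow q (a 0) (a 2)).withTransportedTorus g g' hgg' hg'g hgΩ) R μ DG fdG compG compT compT').conv
              (prodFn ((PlaneData.mixedRow q (a 0) (a 2)).withTransportedTorus g g' hgg' hg'g hgΩ) finf (ffin (lev n))) (f₂ (lev n))) := by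
  -- the Haar data by name: `νf'`, `μinf`, `μ₀`, `νS` are Haar measures (Mathlib's `Measure.haar` on the locally compact
  -- closed subgroups), and the normalisation constants `c c' c₀ cq` exist by Haar uniqueness (TorusProductHaar, GASplit,
  -- TorusFinSplitHaar)
  haveI := locallyCompact_torusFin' ((PlaneData.mixedRow q (a 0) (a 2)).withTransportedTorus g g' hgg' hg'g hgΩ)
  haveI := locallyCompact_infinitePart ((PlaneData.mixedRow q (a 0) (a 2)).withTransportedTorus g g' hgg' hg'g hgΩ)
  haveI := locallyCompact_finitePart ((PlaneData.mixedRow q (a 0) (a 2)).withTransportedTorus g g' hgg' hg'g hgΩ)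
  haveI := locallyCompact_torusFinAt ((PlaneData.mixedRow q (a 0) (a 2)).withTransportedTorus g g' hgg' hg'g hgΩ) (placesAbove (k := k) p)
  haveI : BorelSpace (torusFin' ((PlaneData.mixedRow q (a 0) (a 2)).withTransportedTorus g g' hgg' hg'g hgΩ)) := Subtype.borelSpace _
  haveI : BorelSpace (infinitePart ((PlaneData.mixedRow q (a 0) (a 2)).withTransportedTorus g g' hgg' hg'g hgΩ)) := Subtype.borelSpace _
  haveI : BorelSpace (finitePart ((PlaneData.mixedRow q (a 0) (a 2)).withTransportedTorus g g' hgg' hg'g hgΩ)) := Subtype.borelSpace _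
  haveI : BorelSpace (torusFinAt ((PlaneData.mixedRow q (a 0) (a 2)).withTransportedTorus g g' hgg' hg'g hgΩ) (placesAbove (k := k) p)) := Subtype.borelSpace _
  obtain ⟨c, hc0, hcμ⟩ := exists_smul_map_prod_eq ((PlaneData.mixedRow q (a 0) (a 2)).withTransportedTorus g g' hgg' hg'g hgΩ) R.μT νinf νf
  obtain ⟨c', hc0', hcμ'⟩ := exists_smul_map_prod_eq' ((PlaneData.mixedRow q (a 0) (a 2)).withTransportedTorus g g' hgg' hg'g hgΩ) R.μT' νinf' (Measure.haar : Measure (torusFin' ((PlaneData.mixedRow q (a 0) (a 2)).withTransportedTorus g g' hgg' hg'g hgΩ)))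
  obtain ⟨c₀, hc₀, hcμ₀⟩ := exists_smul_map_prod_eq_ga ((PlaneData.mixedRow q (a 0) (a 2)).withTransportedTorus g g' hgg' hg'g hgΩ) μ (Measure.haar : Measure (infinitePart ((PlaneData.mixedRow q (a 0) (a 2)).withTransportedTorus g g' hgg' hg'g hgΩ)))
    (Measure.haar : Measure (finitePart ((PlaneData.mixedRow q (a 0) (a 2)).withTransportedTorus g g' hgg' hg'g hgΩ)))
  obtain ⟨cq, -, hcq⟩ := exists_smul_map_prod_eq_fin ((PlaneData.mixedRow q (a 0) (a 2)).withTransportedTorus g g' hgg' hg'g hgΩ) (placesAbove (k := k) p) νf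
    (Measure.haar : Measure (torusFinAt ((PlaneData.mixedRow q (a 0) (a 2)).withTransportedTorus g g' hgg' hg'g hgΩ) (placesAbove (k := k) p))) νA
  exact tailForArch_seesaw_of_ratio q ht hn a ha g g' hgg' hg'g hgΩ lam hlam hiso R hRH hc hu hc' hu' w₀ eP eM eP' eM'
    hchi hchi' μ DG fdG compG compT compT' γ₀ hlin νinf νf c hc0 hcμ νinf' _ c' hc0' hcμ' p hp hγ₀ νA νA' DA hDA hfd hDZc
    haway _ _ c₀ hc₀ hcμ₀ _ cq hcq hw hcm hα hβ hdef


/-- **The (7b) display body at the plane of record with the compactness of the archimedean tori by name**: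
`tailForArch_seesaw_of_ratio_haar` with the two instance binders `[CompactSpace (torusInf W′)]` `[CompactSpace (torusInf' W′)]`
DELETED — they are L1-p5's `compactSpace_torusInf_seesaw` (ArchCutoffLarge; typer-2's TorusInfCompact) and typer-2's
`compactSpace_infinitePart_subgroupOf_torusT'_seesaw` (TorusInfCompactConj) from `ha`, `lam hlam hiso`, total reality and CM
at every place (`hw`, `hcm` at `w₀`, `hdef` elsewhere).  THE RESIDUAL (the (7b) census at this layer): `ht` · the Haar
measures `νinf νf νinf' νA νA'` · the product `Z(k)`-domain data `DA hDA hfd hDZc` · the level prime `p hp hγ₀` · the sign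
data `hw hcm hα hβ hdef` · the K-type matching `hchi hchi'` · (S-FIN-NV)'s display `haway`. -/
theorem tailForArch_seesaw_of_ratio_compact (q : QuadData k) (ht : q.t = 0) (hn : ¬ IsSquare (-q.n))
    (a : Fin 4 → k) (ha : ∀ i, a i ≠ 0)
    (g g' : Matrix (Fin 4) (Fin 4) k) (hgg' : g * g' = 1) (hg'g : g' * g = 1)
    (hgΩ : g * (PlaneData.mixedRow q (a 0) (a 2)).Ω = (PlaneData.mixedRow q (a 0) (a 2)).Ω * g)
    (lam : k) (hlam : lam ≠ 0)
    (hiso : g * (PlaneData.mixedRow q (a 1) (a 3)).B * gᵀ = lam • (PlaneData.mixedRow q (a 0) (a 2)).B)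
    [MeasurableSpace (GA ((PlaneData.mixedRow q (a 0) (a 2)).withTransportedTorus g g' hgg' hg'g hgΩ))] [BorelSpace (GA ((PlaneData.mixedRow q (a 0) (a 2)).withTransportedTorus g g' hgg' hg'g hgΩ))]
    (R : RTFData ((PlaneData.mixedRow q (a 0) (a 2)).withTransportedTorus g g' hgg' hg'g hgΩ)) (hRH : R.IsHaar)
    (hc : Continuous R.chi) (hu : ∀ a, ‖R.chi a‖ = 1) (hc' : Continuous R.chi') (hu' : ∀ a, ‖R.chi' a‖ = 1)
    (w₀ : InfinitePlace k) (eP eM eP' eM' : InfinitePlace k → ℤ)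
    -- the K-type matching of the display (its own `_hchi` / `_hchi'`), in `D : KTypeData`'s place
    (hchi : ∀ w, ChiMatchesAt ((PlaneData.mixedRow q (a 0) (a 2)).withTransportedTorus g g' hgg' hg'g hgΩ) q w (eP w) (eM w) R.chi)
    (hchi' : ∀ w, ChiMatchesAt' ((PlaneData.mixedRow q (a 0) (a 2)).withTransportedTorus g g' hgg' hg'g hgΩ) q w g g' (eP' w) (eM' w) R.chi')
    [R.μT.IsHaarMeasure] [R.μT'.IsHaarMeasure]
    (μ : Measure (GA ((PlaneData.mixedRow q (a 0) (a 2)).withTransportedTorus g g' hgg' hg'g hgΩ))) [μ.IsHaarMeasure] (DG : Set (GA ((PlaneData.mixedRow q (a 0) (a 2)).withTransportedTorus g g' hgg' hg'g hgΩ))) (fdG : IsFundamentalDomain (rationalPoints ((PlaneData.mixedRow q (a 0) (a 2)).withTransportedTorus g g' hgg' hg'g hgΩ)) DG μ)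
    (compG : IsCompact (closure DG)) (compT : IsCompact (closure R.DT)) (compT' : IsCompact (closure R.DT'))
    (γ₀ : rationalPoints ((PlaneData.mixedRow q (a 0) (a 2)).withTransportedTorus g g' hgg' hg'g hgΩ)) (hlin : IsLinRegular ((PlaneData.mixedRow q (a 0) (a 2)).withTransportedTorus g g' hgg' hg'g hgΩ) γ₀)
    (νinf : Measure (torusInf ((PlaneData.mixedRow q (a 0) (a 2)).withTransportedTorus g g' hgg' hg'g hgΩ))) [νinf.IsHaarMeasure]
    (νf : Measure (torusFin ((PlaneData.mixedRow q (a 0) (a 2)).withTransportedTorus g g' hgg' hg'g hgΩ))) [νf.IsHaarMeasure]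
    (νinf' : Measure (torusInf' ((PlaneData.mixedRow q (a 0) (a 2)).withTransportedTorus g g' hgg' hg'g hgΩ))) [νinf'.IsHaarMeasure]
    (p : ℕ) (hp : p.Prime)
    (hγ₀ : ∀ v : HeightOneSpectrum (𝓞 k), natSize k v p < 1 → ∀ i j : Fin 4,
      Valued.v (finPart k (GA.mat ((PlaneData.mixedRow q (a 0) (a 2)).withTransportedTorus g g' hgg' hg'g hgΩ) (γ₀ : GA ((PlaneData.mixedRow q (a 0) (a 2)).withTransportedTorus g g' hgg' hg'g hgΩ)) i j) v) ≤ 1 ∧ Valued.v (finPart k (GA.mat ((PlaneData.mixedRow q (a 0) (a 2)).withTransportedTorus g g' hgg' hg'g hgΩ) (γ₀ : GA ((PlaneData.mixedRow q (a 0) (a 2)).withTransportedTorus g g' hgg' hg'g hgΩ))⁻¹ i j) v) ≤ 1)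
    -- the product `Z(k)`-domain of record `torusFinSplit⁻¹(univ ×ˢ DA)` (AwayDomain) and its fundamental-domain /
    -- compactness data (ZDOMAIN-EX (iv) at the product domain); the away measures and (S-FIN-NV)'s display `haway`
    (νA : Measure (torusFinAway ((PlaneData.mixedRow q (a 0) (a 2)).withTransportedTorus g g' hgg' hg'g hgΩ) (placesAbove (k := k) p))) [νA.IsHaarMeasure]
    (νA' : Measure (torusFinAway' ((PlaneData.mixedRow q (a 0) (a 2)).withTransportedTorus g g' hgg' hg'g hgΩ) (placesAbove (k := k) p))) [νA'.IsHaarMeasure]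
    (DA : Set (torusFinAway ((PlaneData.mixedRow q (a 0) (a 2)).withTransportedTorus g g' hgg' hg'g hgΩ) (placesAbove (k := k) p))) (hDA : MeasurableSet DA)
    (hfd : IsFundamentalDomain (centreFin ((PlaneData.mixedRow q (a 0) (a 2)).withTransportedTorus g g' hgg' hg'g hgΩ)) ((torusFinSplit ((PlaneData.mixedRow q (a 0) (a 2)).withTransportedTorus g g' hgg' hg'g hgΩ) (placesAbove (k := k) p)) ⁻¹' (Set.univ ×ˢ DA)) νf)
    (hDZc : ∀ C : Set (torusFin ((PlaneData.mixedRow q (a 0) (a 2)).withTransportedTorus g g' hgg' hg'g hgΩ)), IsCompact C → IsCompact (closure (((torusFinSplit ((PlaneData.mixedRow q (a 0) (a 2)).withTransportedTorus g g' hgg' hg'g hgΩ) (placesAbove (k := k) p)) ⁻¹' (Set.univ ×ˢ DA)) ∩ (C * (ZfIn ((PlaneData.mixedRow q (a 0) (a 2)).withTransportedTorus g g' hgg' hg'g hgΩ) : Set (torusFin ((PlaneData.mixedRow q (a 0) (a 2)).withTransportedTorus g g' hgg' hg'g hgΩ)))))))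
    (haway : awayOrbital ((PlaneData.mixedRow q (a 0) (a 2)).withTransportedTorus g g' hgg' hg'g hgΩ) (placesAbove (k := k) p) R (γ₀ : GA ((PlaneData.mixedRow q (a 0) (a 2)).withTransportedTorus g g' hgg' hg'g hgΩ)) νA νA' DA ≠ 0)
    -- (S-COUNT) BY NAME: the sign data of display (8) in `hcount`'s place — `w₀` (already bound: the indefinite place of
    -- `IsArchCoeffD`) real and CM, the `(1,1)` signs `hα hβ` at `w₀`, and the ONE displayed definiteness clause `hdef`
    (hw : w₀.IsReal) (hcm : IsCMAt q w₀) (hα : 0 < alphaLoc (a 0) hw) (hβ : betaLoc (a 2) (-1) hw < 0)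
    (hdef : SeesawDefinite q a w₀) :
    ∀ finf : GA ((PlaneData.mixedRow q (a 0) (a 2)).withTransportedTorus g g' hgg' hg'g hgΩ) → ℂ,
      IsArchCoeffD ((PlaneData.mixedRow q (a 0) (a 2)).withTransportedTorus g g' hgg' hg'g hgΩ) (Setting.ofAdelicData ((PlaneData.mixedRow q (a 0) (a 2)).withTransportedTorus g g' hgg' hg'g hgΩ) R μ DG fdG compG compT compT') R q g g' w₀ eP eM eP' eM'
        (γ₀ : GA ((PlaneData.mixedRow q (a 0) (a 2)).withTransportedTorus g g' hgg' hg'g hgΩ)) νinf νinf' finf →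
      ∃ lev : ℕ → ℕ, (∀ n, lev n ≠ 0) ∧
      ∃ ffin f₂ : ℕ → GA ((PlaneData.mixedRow q (a 0) (a 2)).withTransportedTorus g g' hgg' hg'g hgΩ) → ℂ, TailFamily' ((PlaneData.mixedRow q (a 0) (a 2)).withTransportedTorus g g' hgg' hg'g hgΩ) q g g' eP' eM' (γ₀ : GA ((PlaneData.mixedRow q (a 0) (a 2)).withTransportedTorus g g' hgg' hg'g hgΩ)) ffin f₂ ∧
        ∃ E : Finset (Setting.ofAdelicData ((PlaneData.mixedRow q (a 0) (a 2)).withTransportedTorus g g' hgg' hg'g hgΩ) R μ DG fdG compG compT compT').Orbit,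
          (Setting.ofAdelicData ((PlaneData.mixedRow q (a 0) (a 2)).withTransportedTorus g g' hgg' hg'g hgΩ) R μ DG fdG compG compT compT').orbitOf γ₀ ∈ E ∧
          FibreDominatedFrom (Setting.ofAdelicData ((PlaneData.mixedRow q (a 0) (a 2)).withTransportedTorus g g' hgg' hg'g hgΩ) R μ DG fdG compG compT compT') R.chi R.chi' E
            (fun n => (Setting.ofAdelicData ((PlaneData.mixedRow q (a 0) (a 2)).withTransportedTorus g g' hgg' hg'g hgΩ) R μ DG fdG compG compT compT').conv
              (prodFn ((PlaneData.mixedRow q (a 0) (a 2)).withTransportedTorus g g' hgg' hg'g hgΩ) finf (ffin (lev n))) (f₂ (lev n))) := by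
  -- every infinite place of `k` is real and CM (`hw`, `hcm` at `w₀`; `hdef` elsewhere): `T_∞` and `T′_∞` are compact
  have hreal : ∀ w : InfinitePlace k, w.IsReal := fun w => by
    by_cases h : w = w₀
    · exact h ▸ hw
    · exact (hdef w h).1
  have hcmAll : ∀ w : InfinitePlace k, IsCMAt q w := fun w => by
    by_cases h : w = w₀
    · exact h ▸ hcm
    · exact (hdef w h).2.1
  haveI : CompactSpace (torusInf ((PlaneData.mixedRow q (a 0) (a 2)).withTransportedTorus g g' hgg' hg'g hgΩ)) :=
    compactSpace_torusInf_seesaw q a g g' hgg' hg'g hgΩ (ha 0) (ha 2) hreal hcmAll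
  haveI : CompactSpace (torusInf' ((PlaneData.mixedRow q (a 0) (a 2)).withTransportedTorus g g' hgg' hg'g hgΩ)) :=
    compactSpace_infinitePart_subgroupOf_torusT'_seesaw q a g g' hgg' hg'g hgΩ lam hlam hiso (ha 1) (ha 3) hreal hcmAll
  exact tailForArch_seesaw_of_ratio_haar q ht hn a ha g g' hgg' hg'g hgΩ lam hlam hiso R hRH hc hu hc' hu' w₀ eP eM eP'
    eM' hchi hchi' μ DG fdG compG compT compT' γ₀ hlin νinf νf νinf' p hp hγ₀ νA νA' DA hDA hfd hDZc haway hw hcm hα hβ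
    hdef

end Haar

end Summit.Ventures.HodgeRepro.Tier4.Line4

end
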